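import Literature.NumberTheory.Automorphic.HarishChandraGLExistence
import Literature.Algebra.Lie.CasimirElement
import HarnessLib

/-!
# The Casimir element of `𝔤𝔩₂(ℝ)` and its scalar `s₁² + s₂² - 1/2` on modules of Harish-Chandra
parameter `{s₁, s₂}` (Knapp 2002, Thm. 5.44; the archimedean input of Gelbart 1997, Remark 2.5.5)

Topic `NumberTheory/Automorphic`; a computation on top of the tree's Harish-Chandra homomorphism
for `𝔤𝔩ₙ` (`HarishChandraGL`, `HarishChandraGLExistence`: the hypothesis structure
`HarishChandraHomGL`, pinned down by its action on highest weight vectors, its existence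
`nonempty_harishChandraHomGL_holds`, the model `HCModel.hwVec` with highest weight vectors of every
weight, and the predicate `HasHCParameter ρ χ` — `Z(𝔤)` acts by the character `z ↦ γ(z)(χ)`).
The tree reads the archimedean component of an automorphic representation only through
`HasHCParameter` (`AutomorphicRepData.HasArchParameter`, and for `GL₂/ℚ` the weight-one predicate
`AutomorphicRepData.IsOfWeightOne` of `StrongArtinGL2WeightOneDictionary`: parameter `{0, 0}`); to
use it on vectors one needs the value of `γ` on an explicit central element. This file supplies it
for `n = 2`, `𝕜 = ℝ`:

* `GLnCasimir.traceForm n` (`tr(XY)`, symmetric, invariant, non-degenerate; dual basis of the matrix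
  units `(E_{ab})^∨ = E_{ba}`), `GLnCasimir.casimir n = C` — the Casimir element of the trace form,
  i.e. the tree's `Literature.Algebra.Lie.casimirElement` in the enveloping algebra of
  `Matrix (Fin n) (Fin n) ℝ` (the domain of `HasHCParameter`); `casimir_eq_sum` — `C = ∑_{a,b} E_{ab} E_{ba}`;
  `casimir_mem_center` (from `casimirElement_mem_center`); `GLnCasimir.zed n = Z = ι(1)`,
  `zed_mem_center`; `casimirZ`, `zedZ` — as elements of `Z(𝔤)`.
* `GL2Casimir.lift_casimir_apply_of_isHighestWeightVector` — **on a highest weight vector of weight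
  `λ`, `C v = (λ₁² + λ₂² + λ₁ - λ₂) v`** (`E₁₂ v = 0`, `E₁₂E₂₁ v = [E₁₂, E₂₁] v = (E₁₁ - E₂₂) v`);
  `lift_zed_apply_of_isHighestWeightVector` — `Z v = (λ₁ + λ₂) v`.
* `GL2Casimir.aeval_harishChandra_casimirZ` — **`γ(C)(x) = x₁² + x₂² - 1/2`** for every
  Harish-Chandra homomorphism `γ` of `𝔤𝔩₂(ℝ)` (evaluate on the model's highest weight vector of
  weight `x - ρ`, `ρ = (½, -½)`); `aeval_harishChandra_zedZ` — `γ(Z)(x) = x₁ + x₂`.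
* `GL2Casimir.lift_casimir_eq_of_hasHCParameter`, `sum_rho_single_apply_of_hasHCParameter` — **on a
  `𝔤𝔩₂(ℝ)`-module of Harish-Chandra parameter `{s₁, s₂}`, `C` acts by `s₁² + s₂² - 1/2`**, i.e.
  `∑_{a,b} ρ(E_{ab}) ρ(E_{ba}) v = (s₁² + s₂² - ½) v`; `lift_zed_eq_of_hasHCParameter`,
  `rho_one_apply_of_hasHCParameter` — `Z` acts by `s₁ + s₂`. For the principal series
  `π(|·|^{s₁}sgn^{ε₁}, |·|^{s₂}sgn^{ε₂})` of `GL₂(ℝ)` these are the familiar values (in Bump's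
  normalisation `C = Ω + ½Z²`, `Ω = ½h² + ef + fe = -2Δ`, Bump 1997, §2.2); for the weight-one
  parameter `{0, 0}` (`π(1, sgn)`, Gelbart 1997, Remark 2.5.2/2.5.5): `C = -1/2`, `Z = 0`, hence
  `Ω = -1/2`, the hypothesis of the weight-one extraction of `GL2WeightVectors`.

Everything is proved; the definitions are the two central elements (and their `Subalgebra.center`
packaging).

## References

* A. W. Knapp, *Lie Groups Beyond an Introduction*, 2nd ed. (2002), §V.4 (Casimir element,
  Prop. 5.24), §V.5 (Lemma 5.42, (5.43), Thm. 5.44) [Knapp2002].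
* S. Gelbart, *Three lectures on the modularity of `ρ̄_{E,3}` …* (1997), Remark 2.5.2 and
  Remark 2.5.5 [Gelbart1997].
* D. Bump, *Automorphic Forms and Representations* (1997), §2.2 (Prop. 2.2.5, (1.29)) [Bump1997].
-/

noncomputable section

-- Mathlib idiom (Mathlib/Algebra/Lie/OfAssociative.lean); needed to mention Lie subalgebras of matrix algebras
attribute [local instance 100] LieRing.ofAssociativeRing

open scoped Matrix
open UniversalEnvelopingAlgebra

namespace Literature.NumberTheory.Automorphic

open HCSpan

namespace GLnCasimir

variable (n : ℕ)

/-- **The trace form** `B(X, Y) = tr(XY)` on `𝔤𝔩ₙ(ℝ)` (a non-degenerate symmetric invariant bilinear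
form; Knapp 2002, §I.8 and §V.4). [cite: Knapp2002, §V.4] -/
def traceForm : LinearMap.BilinForm ℝ (Matrix (Fin n) (Fin n) ℝ) :=
  LinearMap.mk₂ ℝ (fun X Y => (X * Y).trace)
    (fun X X' Y => by rw [Matrix.add_mul, Matrix.trace_add])
    (fun c X Y => by rw [Matrix.smul_mul, Matrix.trace_smul, smul_eq_mul])
    (fun X Y Y' => by rw [Matrix.mul_add, Matrix.trace_add])
    (fun c X Y => by rw [Matrix.mul_smul, Matrix.trace_smul, smul_eq_mul])

/-- `B(X, Y) = tr(XY)`. [folklore] -/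
@[simp] theorem traceForm_apply (X Y : Matrix (Fin n) (Fin n) ℝ) : traceForm n X Y = (X * Y).trace := rfl

/-- The trace form is symmetric (`tr(XY) = tr(YX)`). [folklore] -/
theorem traceForm_isSymm : (traceForm n).IsSymm :=
  ⟨fun X Y => by rw [traceForm_apply, traceForm_apply, Matrix.trace_mul_comm]⟩

/-- The trace form is invariant: `tr([X,Y] Z) = -tr(Y [X,Z])`. [cite: Knapp2002, §I.8] -/
theorem traceForm_lieInvariant : (traceForm n).lieInvariant (Matrix (Fin n) (Fin n) ℝ) := by
  intro X Y Z
  simp only [traceForm_apply, Ring.lie_def, Matrix.sub_mul, Matrix.mul_sub, Matrix.trace_sub]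
  rw [← Matrix.mul_assoc Y Z X, Matrix.trace_mul_cycle Y Z X, Matrix.mul_assoc X Y Z, Matrix.mul_assoc Y X Z]
  ring

/-- `tr(X E_{ba}) = X_{ab}`. [folklore] -/
theorem traceForm_single (X : Matrix (Fin n) (Fin n) ℝ) (a b : Fin n) :
    traceForm n X (Matrix.single b a (1 : ℝ)) = X a b := by
  rw [traceForm_apply, Matrix.trace_mul_single]
  simp

/-- The trace form is non-degenerate (`tr(X E_{ba}) = X_{ab}`). [folklore] -/
theorem traceForm_nondegenerate : (traceForm n).Nondegenerate := by
  refine ⟨fun X hX => ?_, fun Y hY => ?_⟩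
  · ext a b
    have h := hX (Matrix.single b a (1 : ℝ))
    rwa [traceForm_single] at h
  · ext a b
    have h := hY (Matrix.single b a (1 : ℝ))
    rw [(traceForm_isSymm n).eq, traceForm_single] at h
    exact h

/-- **The dual basis of the matrix units under the trace form is the transposed family**:
`(E_{ab})^∨ = E_{ba}`. [folklore] -/
theorem dualBasis_traceForm_stdBasis (p : Fin n × Fin n) :
    (traceForm n).dualBasis (traceForm_nondegenerate n) (Matrix.stdBasis ℝ (Fin n) (Fin n)) p =
      Matrix.single p.2 p.1 (1 : ℝ) := by
  classical
  have h := (LinearMap.BilinForm.dualBasis_eq_iff (traceForm_nondegenerate n) (Matrix.stdBasis ℝ (Fin n) (Fin n))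
    (fun q : Fin n × Fin n => Matrix.single q.2 q.1 (1 : ℝ))).2 ?_
  · exact congrFun h p
  · rintro ⟨a, b⟩ ⟨c, d⟩
    rw [Matrix.stdBasis_eq_single, (traceForm_isSymm n).eq, traceForm_single]
    simp only [Matrix.single, Matrix.of_apply, Prod.mk.injEq]

/-- **The Casimir element** `C = ∑_{a,b} E_{ab} E_{ba}` of `U(𝔤𝔩ₙ(ℝ))`: the Casimir element of the
trace form (`Literature.Algebra.Lie.casimirElement`, Bourbaki LIE I §3.7, Knapp 2002, (5.24)) in the
basis of matrix units; the same element as `casimirU` of `RealCasimirGL` at the trivial self-dual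
unit system over `ℝ` ("for `A = ℝ` this is the classical Casimir `∑ E_{ab} E_{ba}`"), here in the
enveloping algebra of `Matrix (Fin n) (Fin n) ℝ` itself (the domain of `HasHCParameter`) rather than
of the Lie subalgebra `⊤`. For `n = 2` and in Bump's notation `C = Ω + ½ Z²`, `Ω = ½h² + ef + fe`,
`Z = E₁₁ + E₂₂` (Bump 1997, §2.2). [cite: Knapp2002, §V.4] -/
def casimir : UGL ℝ n :=
  Literature.Algebra.Lie.casimirElement (traceForm n) (traceForm_nondegenerate n) (Matrix.stdBasis ℝ (Fin n) (Fin n))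

/-- **`C = ∑_{a,b} ι(E_{ab}) ι(E_{ba})`** in the basis of matrix units. [cite: Knapp2002, (5.24)] -/
theorem casimir_eq_sum :
    casimir n = ∑ a : Fin n, ∑ b : Fin n, ιU (Matrix.single a b (1 : ℝ)) * ιU (Matrix.single b a (1 : ℝ)) := by
  classical
  rw [casimir, Literature.Algebra.Lie.casimirElement, Fintype.sum_prod_type]
  refine Finset.sum_congr rfl fun a _ => Finset.sum_congr rfl fun b _ => ?_
  rw [dualBasis_traceForm_stdBasis, Matrix.stdBasis_eq_single]

/-- **The Casimir element is central in `U(𝔤𝔩ₙ(ℝ))`** (`casimirElement_mem_center` for the trace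
form). Knapp 2002, Prop. 5.24. [cite: Knapp2002, §V.4] -/
theorem casimir_mem_center : casimir n ∈ Subalgebra.center ℝ (UGL ℝ n) :=
  Literature.Algebra.Lie.casimirElement_mem_center (traceForm_isSymm n) (traceForm_lieInvariant n) _

/-- The **central element** `Z = ∑_a E_{aa} = ι(1)` of `U(𝔤𝔩ₙ(ℝ))` (the identity matrix, central in
`𝔤𝔩ₙ`). [folklore] -/
def zed : UGL ℝ n :=
  ιU (1 : Matrix (Fin n) (Fin n) ℝ)

/-- `ι[X, Y] = ιX ιY - ιY ιX` in `U(𝔤𝔩ₙ(ℝ))`. [folklore] -/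
theorem ιU_lie (X Y : Matrix (Fin n) (Fin n) ℝ) : ιU ⁅X, Y⁆ = ιU X * ιU Y - ιU Y * ιU X := by
  rw [LieHom.map_lie, Ring.lie_def]

/-- **`Z = ι(1)` is central in `U(𝔤𝔩ₙ(ℝ))`** (`[1, X] = 0`; an element commuting with `ι(L)` is
central, `Literature.Algebra.Lie.mem_center_of_forall_ι_comm`). [folklore] -/
theorem zed_mem_center : zed n ∈ Subalgebra.center ℝ (UGL ℝ n) := by
  refine Literature.Algebra.Lie.mem_center_of_forall_ι_comm fun X => ?_
  have h : ιU ⁅X, (1 : Matrix (Fin n) (Fin n) ℝ)⁆ = 0 := by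
    rw [Ring.lie_def, mul_one, one_mul, sub_self, map_zero]
  rw [ιU_lie, sub_eq_zero] at h
  exact h

/-- The Casimir element as an element of the centre `Z(𝔤𝔩ₙ(ℝ))`. [cite: Knapp2002, §V.4] -/
def casimirZ : Subalgebra.center ℝ (UGL ℝ n) := ⟨casimir n, casimir_mem_center n⟩

/-- `Z = ι(1)` as an element of the centre `Z(𝔤𝔩ₙ(ℝ))`. [folklore] -/
def zedZ : Subalgebra.center ℝ (UGL ℝ n) := ⟨zed n, zed_mem_center n⟩

end GLnCasimir

/-! ### `n = 2`: the Casimir element on highest weight vectors and its Harish-Chandra polynomial -/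

namespace GL2Casimir

open GLnCasimir

/-- All real-algebra maps `ℝ → ℂ` coincide (there is exactly one). [folklore] -/
theorem algHom_real_eq (τ τ' : ℝ →ₐ[ℝ] ℂ) : τ = τ' := Subsingleton.elim _ _

/-- The weight of `E₁₁ = diag(1, 0)`: `l(E₁₁) = l_{τ,0}`. [folklore] -/
theorem weightFun_single_zero (l : ArchWeightGL ℝ 2) (τ : ℝ →ₐ[ℝ] ℂ) :
    weightFun l (Pi.single (0 : Fin 2) (1 : ℝ)) = l τ 0 := by
  rw [weightFun, Fintype.sum_subsingleton _ τ, Fin.sum_univ_two]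
  simp

/-- The weight of `E₂₂ = diag(0, 1)`: `l(E₂₂) = l_{τ,1}`. [folklore] -/
theorem weightFun_single_one (l : ArchWeightGL ℝ 2) (τ : ℝ →ₐ[ℝ] ℂ) :
    weightFun l (Pi.single (1 : Fin 2) (1 : ℝ)) = l τ 1 := by
  rw [weightFun, Fintype.sum_subsingleton _ τ, Fin.sum_univ_two]
  simp

/-- The weight of `Z = 1 = diag(1, 1)`: `l(1) = l_{τ,0} + l_{τ,1}`. [folklore] -/
theorem weightFun_one (l : ArchWeightGL ℝ 2) (τ : ℝ →ₐ[ℝ] ℂ) :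
    weightFun l (fun _ : Fin 2 => (1 : ℝ)) = l τ 0 + l τ 1 := by
  rw [weightFun, Fintype.sum_subsingleton _ τ, Fin.sum_univ_two]
  simp

/-- `E_{aa} = diag(e_a)`. [folklore] -/
theorem single_self_eq_diagonal (a : Fin 2) :
    Matrix.single a a (1 : ℝ) = Matrix.diagonal (Pi.single a (1 : ℝ)) := by
  ext i j
  fin_cases a <;> fin_cases i <;> fin_cases j <;> simp [Matrix.single, Matrix.diagonal]

/-- `E₁₂` is strictly upper triangular. [folklore] -/
theorem single_zero_one_mem_upperNilpLie : Matrix.single (0 : Fin 2) 1 (1 : ℝ) ∈ upperNilpLie ℝ 2 := by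
  rw [mem_upperNilpLie_iff]
  intro i j hji
  fin_cases i <;> fin_cases j <;> simp [Matrix.single] at hji ⊢

variable {V : Type*} [AddCommGroup V] [Module ℂ V] (ρ : Matrix (Fin 2) (Fin 2) ℝ →ₗ⁅ℝ⁆ Module.End ℂ V)

/-- `lift ρ (ιX ιY) v = ρ X (ρ Y v)`. [folklore] -/
theorem lift_ιU_mul_ιU_apply (X Y : Matrix (Fin 2) (Fin 2) ℝ) (v : V) :
    lift ℝ ρ (ιU X * ιU Y) v = ρ X (ρ Y v) := by
  rw [map_mul, Module.End.mul_apply]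
  change lift ℝ ρ (ι ℝ X) (lift ℝ ρ (ι ℝ Y) v) = _
  rw [lift_ι_apply, lift_ι_apply]

variable {ρ}

/-- **The Casimir element on a highest weight vector**: if `v` is a highest weight vector of weight
`λ = (λ₁, λ₂)`, then `C v = (λ₁² + λ₂² + λ₁ - λ₂) v` (`E₁₂ v = 0`, `E₁₂E₂₁ v = [E₁₂, E₂₁] v = (E₁₁ - E₂₂) v`).
Knapp 2002, §V.4–V.5 (the scalar `|λ + δ|² - |δ|²` of the Casimir on a highest weight module).
[cite: Knapp2002, §V.5 (Lemma 5.42, (5.43))] -/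
theorem lift_casimir_apply_of_isHighestWeightVector {l : ArchWeightGL ℝ 2} {v : V}
    (hv : IsHighestWeightVector ρ l v) (τ : ℝ →ₐ[ℝ] ℂ) :
    lift ℝ ρ (casimir 2) v = (l τ 0 ^ 2 + l τ 1 ^ 2 + l τ 0 - l τ 1) • v := by
  have h00 : ρ (Matrix.single 0 0 (1 : ℝ)) v = l τ 0 • v := by
    rw [single_self_eq_diagonal, hv.2.2, weightFun_single_zero l τ]
  have h11 : ρ (Matrix.single 1 1 (1 : ℝ)) v = l τ 1 • v := by
    rw [single_self_eq_diagonal, hv.2.2, weightFun_single_one l τ]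
  have h01 : ρ (Matrix.single 0 1 (1 : ℝ)) v = 0 := hv.2.1 _ single_zero_one_mem_upperNilpLie
  have hbr : ρ (Matrix.single 0 1 (1 : ℝ)) (ρ (Matrix.single 1 0 (1 : ℝ)) v) = (l τ 0 - l τ 1) • v := by
    have h1 : ρ ⁅Matrix.single (0 : Fin 2) (1 : Fin 2) (1 : ℝ), Matrix.single (1 : Fin 2) (0 : Fin 2) (1 : ℝ)⁆ =
        ρ (Matrix.single 0 1 (1 : ℝ)) * ρ (Matrix.single 1 0 (1 : ℝ)) -
          ρ (Matrix.single 1 0 (1 : ℝ)) * ρ (Matrix.single 0 1 (1 : ℝ)) := by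
      have h := LieHom.map_lie ρ (Matrix.single (0 : Fin 2) (1 : Fin 2) (1 : ℝ)) (Matrix.single (1 : Fin 2) (0 : Fin 2) (1 : ℝ))
      rw [h, Ring.lie_def]
    have h1v := LinearMap.congr_fun h1 v
    rw [LinearMap.sub_apply, Module.End.mul_apply, Module.End.mul_apply, h01, map_zero, sub_zero,
      single_lie_single] at h1v
    simp only [if_true, mul_one, map_sub, LinearMap.sub_apply] at h1v
    rw [← h1v, h00, h11, sub_smul]
  simp only [casimir_eq_sum, Fin.sum_univ_two, map_add, LinearMap.add_apply, lift_ιU_mul_ιU_apply, h00, h11, h01,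
    map_zero, map_smul, hbr, smul_smul, zero_add, ← add_smul]
  congr 1
  ring

/-- **`Z` on a highest weight vector**: `Z v = (λ₁ + λ₂) v`. [folklore] -/
theorem lift_zed_apply_of_isHighestWeightVector {l : ArchWeightGL ℝ 2} {v : V}
    (hv : IsHighestWeightVector ρ l v) (τ : ℝ →ₐ[ℝ] ℂ) :
    lift ℝ ρ (zed 2) v = (l τ 0 + l τ 1) • v := by
  change lift ℝ ρ (ι ℝ (1 : Matrix (Fin 2) (Fin 2) ℝ)) v = _
  rw [lift_ι_apply, show (1 : Matrix (Fin 2) (Fin 2) ℝ) = Matrix.diagonal (fun _ => (1 : ℝ)) from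
    (Matrix.diagonal_one).symm, hv.2.2, weightFun_one l τ]

/-- `ρ = (1/2, -1/2)` for `𝔤𝔩₂`. [folklore] -/
theorem rhoGL_two_zero : rhoGL 2 0 = 1 / 2 := by
  simp [rhoGL]; norm_num

/-- `ρ = (1/2, -1/2)` for `𝔤𝔩₂`. [folklore] -/
theorem rhoGL_two_one : rhoGL 2 1 = -(1 / 2) := by
  simp [rhoGL]; norm_num

/-- **The Harish-Chandra polynomial of the Casimir element of `𝔤𝔩₂(ℝ)` is `x₁² + x₂² - 1/2`**:
`γ(C)(x) = x₁² + x₂² - 1/2` for every Harish-Chandra homomorphism `γ` (evaluate on the highest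
weight vector of weight `x - ρ` of the model of `HarishChandraGLModel`, on which `C` acts by
`λ₁² + λ₂² + λ₁ - λ₂` with `λ = x - ρ = (x₁ - ½, x₂ + ½)`). Knapp 2002, Thm. 5.44 with (5.43).
[cite: Knapp2002, Thm. 5.44] -/
theorem aeval_harishChandra_casimirZ (γ : HarishChandraHomGL ℝ 2) (x : (ℝ →ₐ[ℝ] ℂ) → Fin 2 → ℂ)
    (τ : ℝ →ₐ[ℝ] ℂ) :
    MvPolynomial.aeval (fun p : (ℝ →ₐ[ℝ] ℂ) × Fin 2 => x p.1 p.2) (γ.toAlgHom (casimirZ 2)) =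
      x τ 0 ^ 2 + x τ 1 ^ 2 - 1 / 2 := by
  set lam : ArchWeightGL ℝ 2 := fun σ i => x σ i - rhoGL 2 i with hlam
  have hv := HCModel.isHighestWeightVector_hwVec (𝕜 := ℝ) (n := 2) lam
  have key := γ.highestWeight _ (HCModel.modelRep ℝ 2).rho lam (HCModel.hwVec lam) hv (casimirZ 2)
  have hx : (fun p : (ℝ →ₐ[ℝ] ℂ) × Fin 2 => lam p.1 p.2 + rhoGL 2 p.2) = fun p => x p.1 p.2 := by
    funext p; simp [hlam]
  rw [hx] at key
  change lift ℝ (HCModel.modelRep ℝ 2).rho (casimir 2) (HCModel.hwVec lam) = _ at key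
  rw [lift_casimir_apply_of_isHighestWeightVector hv τ] at key
  have hinj := smul_hwVec_injective (𝕜 := ℝ) (n := 2) lam
  have h := hinj key
  rw [← h]
  simp only [hlam, rhoGL_two_zero, rhoGL_two_one]
  ring

/-- **The Harish-Chandra polynomial of `Z` is `x₁ + x₂`.** [cite: Knapp2002, Thm. 5.44] -/
theorem aeval_harishChandra_zedZ (γ : HarishChandraHomGL ℝ 2) (x : (ℝ →ₐ[ℝ] ℂ) → Fin 2 → ℂ)
    (τ : ℝ →ₐ[ℝ] ℂ) :
    MvPolynomial.aeval (fun p : (ℝ →ₐ[ℝ] ℂ) × Fin 2 => x p.1 p.2) (γ.toAlgHom (zedZ 2)) = x τ 0 + x τ 1 := by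
  set lam : ArchWeightGL ℝ 2 := fun σ i => x σ i - rhoGL 2 i with hlam
  have hv := HCModel.isHighestWeightVector_hwVec (𝕜 := ℝ) (n := 2) lam
  have key := γ.highestWeight _ (HCModel.modelRep ℝ 2).rho lam (HCModel.hwVec lam) hv (zedZ 2)
  have hx : (fun p : (ℝ →ₐ[ℝ] ℂ) × Fin 2 => lam p.1 p.2 + rhoGL 2 p.2) = fun p => x p.1 p.2 := by
    funext p; simp [hlam]
  rw [hx] at key
  change lift ℝ (HCModel.modelRep ℝ 2).rho (zed 2) (HCModel.hwVec lam) = _ at key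
  rw [lift_zed_apply_of_isHighestWeightVector hv τ] at key
  have hinj := smul_hwVec_injective (𝕜 := ℝ) (n := 2) lam
  have h := hinj key
  rw [← h]
  simp only [hlam, rhoGL_two_zero, rhoGL_two_one]
  ring

/-- The enumeration `(s₁, s₂)` of the multiset `{s₁, s₂}`. [folklore] -/
theorem univ_val_map_vecCons (s₁ s₂ : ℂ) :
    (Finset.univ : Finset (Fin 2)).val.map ![s₁, s₂] = ({s₁, s₂} : Multiset ℂ) := by
  simp [Fin.univ_val_map]
  rfl

/-- **On a `𝔤𝔩₂(ℝ)`-module of Harish-Chandra parameter `{s₁, s₂}` the Casimir element acts by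
`s₁² + s₂² - 1/2`** (its infinitesimal character evaluates `γ(C) = x₁² + x₂² - 1/2` at `(s₁, s₂)`).
For the principal series `π(|·|^{s₁} sgn^{ε₁}, |·|^{s₂} sgn^{ε₂})` of `GL₂(ℝ)` this is the familiar
Casimir/Laplace eigenvalue (Bump 1997, §2.2; Gelbart 1997, Remark 2.5.5); parameter `{0, 0}`
(weight one, `π(1, sgn)`) gives `-1/2`. [cite: Knapp2002, Thm. 5.44] [cite: Gelbart1997, Remark 2.5.5] -/
theorem lift_casimir_eq_of_hasHCParameter {s₁ s₂ : ℂ} (h : HasHCParameter ρ fun _ => ({s₁, s₂} : Multiset ℂ)) :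
    lift ℝ ρ (casimir 2) = algebraMap ℂ (Module.End ℂ V) (s₁ ^ 2 + s₂ ^ 2 - 1 / 2) := by
  obtain ⟨-, θ, hθ, hγ⟩ := h
  obtain ⟨γ⟩ := nonempty_harishChandraHomGL_holds ℝ 2
  have τ : ℝ →ₐ[ℝ] ℂ := Algebra.ofId ℝ ℂ
  have h1 := hθ (casimirZ 2)
  have h2 := hγ γ (fun _ => ![s₁, s₂]) (fun _ => univ_val_map_vecCons s₁ s₂) (casimirZ 2)
  have h3 := aeval_harishChandra_casimirZ γ (fun _ => ![s₁, s₂]) τ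
  rw [h3] at h2
  change lift ℝ ρ (casimir 2) = _ at h1
  rw [h1, h2]
  simp

/-- **On a `𝔤𝔩₂(ℝ)`-module of Harish-Chandra parameter `{s₁, s₂}`, `Z` acts by `s₁ + s₂`.**
[cite: Knapp2002, Thm. 5.44] -/
theorem lift_zed_eq_of_hasHCParameter {s₁ s₂ : ℂ} (h : HasHCParameter ρ fun _ => ({s₁, s₂} : Multiset ℂ)) :
    lift ℝ ρ (zed 2) = algebraMap ℂ (Module.End ℂ V) (s₁ + s₂) := by
  obtain ⟨-, θ, hθ, hγ⟩ := h
  obtain ⟨γ⟩ := nonempty_harishChandraHomGL_holds ℝ 2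
  have τ : ℝ →ₐ[ℝ] ℂ := Algebra.ofId ℝ ℂ
  have h1 := hθ (zedZ 2)
  have h2 := hγ γ (fun _ => ![s₁, s₂]) (fun _ => univ_val_map_vecCons s₁ s₂) (zedZ 2)
  have h3 := aeval_harishChandra_zedZ γ (fun _ => ![s₁, s₂]) τ
  rw [h3] at h2
  change lift ℝ ρ (zed 2) = _ at h1
  rw [h1, h2]
  simp

/-- The same two statements in applied form: `ρ(E₁₁)ρ(E₁₁) + ρ(E₁₂)ρ(E₂₁) + ρ(E₂₁)ρ(E₁₂) + ρ(E₂₂)ρ(E₂₂) = (s₁² + s₂² - ½) · 1`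
on vectors. [cite: Knapp2002, Thm. 5.44] -/
theorem sum_rho_single_apply_of_hasHCParameter {s₁ s₂ : ℂ}
    (h : HasHCParameter ρ fun _ => ({s₁, s₂} : Multiset ℂ)) (v : V) :
    (∑ a : Fin 2, ∑ b : Fin 2, ρ (Matrix.single a b (1 : ℝ)) (ρ (Matrix.single b a (1 : ℝ)) v)) =
      (s₁ ^ 2 + s₂ ^ 2 - 1 / 2) • v := by
  have h1 := congrArg (fun T : Module.End ℂ V => T v) (lift_casimir_eq_of_hasHCParameter h)
  simp only [casimir_eq_sum, map_sum, LinearMap.sum_apply, lift_ιU_mul_ιU_apply, Module.algebraMap_end_apply] at h1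
  exact h1

/-- `ρ(1) v = (s₁ + s₂) v` on a module of Harish-Chandra parameter `{s₁, s₂}`. [cite: Knapp2002, Thm. 5.44] -/
theorem rho_one_apply_of_hasHCParameter {s₁ s₂ : ℂ}
    (h : HasHCParameter ρ fun _ => ({s₁, s₂} : Multiset ℂ)) (v : V) :
    ρ (1 : Matrix (Fin 2) (Fin 2) ℝ) v = (s₁ + s₂) • v := by
  have h1 := congrArg (fun T : Module.End ℂ V => T v) (lift_zed_eq_of_hasHCParameter h)
  simp only [Module.algebraMap_end_apply] at h1
  change lift ℝ ρ (ι ℝ (1 : Matrix (Fin 2) (Fin 2) ℝ)) v = _ at h1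
  rwa [lift_ι_apply] at h1

end GL2Casimir

end Literature.NumberTheory.Automorphic

end
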